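import Summits.QuantumFields.YangMills.Theorems.BalabanUVNodesN11Thm2PointCountAtRecord13CoPH

/-!
# DAG node N11 — THE p. 263 COUNT FOR THE 𝐑-SIDE OF [III] THEOREM 2 AT THE ₁₃ OBJECTS: the CUBES of `𝐃_j` («z is an arbitrary point from X», p. 283 — this seat reads it as a chosen
# `M`-cube of `X`) of scale `n` number at most `(L^{n−j})⁴·|Γ_n(s)|` — each cube of `T₁^{(j)}` owns a point of `T₁^{(j)}` inside it (an injection), so the cube count is a point count

Cell `pub-ymgap`, YM-PLAN Track A (HUMAN RULING D-0062 ∕ D-0149), seat `pub-ymgap-dag-n11-w2` (g0), route `BalabanUVNodes`, key item K1⁷ `StabilityBAtRecordR13SepCoPH` =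
stmt-QuantumFields-20542 (helper, count-neutral).  Sequel of this seat's `…Thm2PointCountAtRecord13CoPH` (the p. 263 POINT count at the record, hypothesis-free: `hcount_at_record₁₃`,
`isBlockUnion_gammaRegion`); serves the binder `hcountR` of `…Thm2RSideAtRecord13CoPH` ∕ `…OfSect3Sentences` (the chosen cubes `pick X` of scale `n`).  [III] = [Balaban1988Convergent].

WHAT THIS FILE PROVES (0 `sorry`, 0 `def`, standard axioms; count-neutral; lattice bookkeeping only).
§1 torus (`P : Params`, `j ≤ m + K`, `1 ≤ M`): `sitesPerDir_mul_pow` (`|T₁^{(j)}|_dir·Lʲ = |T_η|_dir`) · `val_mul_lt_sitesPerDir` (a cube index times `M` is a scale-`j` label) · ★ `exists_site_in_domCube`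
(an INJECTION `ι : cubes of 𝐃_j → T₁^{(j)}` with `toFine j (ι x) ∈` the cube `x` read as fine sites — the point `(x·M)` of `T₁^{(j)}`, whose centre lies in the cube by `B10Eq71TorusOverlap.cubeIdx_toFine`).
§2 at the ₁₃ objects: ★★ `hcountR_at_record₁₃` — for a history `s`, `1 ≤ j ≤ n ≤ m + K`, `1 ≤ M` (`M = θ.τ9.M`), any finite set `Zc` of cubes of `𝐃_j` of record and any scale map `scR` whose
scale-`n` cubes lie INSIDE `Γ_n(s)` as fine-site sets (`hsc`): `#{x ∈ Zc : scR x = n} ≤ (L^{n−j})⁴·|Γ_n(s)|`, `|Γ_n(s)| = #{y ∈ T₁^{(n)} : y ∈ Γ_n(s)}` — the `hcountR` binder at `L := (F.P p.K).L`,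
NO geometric hypothesis beyond `1 ≤ M`.

HONEST FRAMING.  N11 NOT discharged; K1⁷ NOT closed; counts unmoved (typed 28∕28 · discharged 5∕27).  One finite four-torus programme at fixed `ε = L^{−K}`; R4 closes only the conditional
finite-𝕋⁴ rung `BalabanLadder.UV`; NOT ℝ⁴, NOT OS, NOT a mass gap, NOT Clay.  Sources: [III] p. 263 (after (2.43)), p. 283, (2.1)–(2.2) pp. 254–255; [I] (0.1) p. 251, p. 257 (the cubes π_j).
-/

noncomputable section

open scoped BigOperators

namespace Summit.QuantumFields.YangMills.Theorems.BalabanUVNodesN11Thm2CubeCountAtRecord13CoPH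

open Literature.MathematicalPhysics.QuantumFieldTheory.Balaban1983to89 Finset
open B15DeterminingSets (gammaRegion)
open B10Eq38TorusDomains (toFine)
open B14.Eq213MaximalDomains (side cubeExt)
open B15Eq112TorusCover (cover lift cover_lift)
open TreeLengthTorus (TPt)
open T4Continuum
open Node00 hiding blockIter
open BalabanUVNodesN11Thm2PointCountAtRecord13CoPH (hcount_at_record₁₃ card_filter_toFine_mem isBlockUnion_gammaRegion)

/-! ## §1. Each `M`-cube of `T₁^{(j)}` owns a point of `T₁^{(j)}` -/

section Torus

variable {P : Params}

/-- `|T₁^{(j)}|_dir · Lʲ = |T_η|_dir` (`2L^{m+K−j}·Lʲ = 2L^{m+K}`, `j ≤ m + K`). [cite: Balaban1987RG1, (0.1) p.251 (bookkeeping)] -/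
theorem sitesPerDir_mul_pow {j : ℕ} (hj : j ≤ P.m + P.K) : P.sitesPerDir j * P.L ^ j = P.sitesPerDir 0 := by
  unfold Params.sitesPerDir
  rw [Nat.sub_zero, mul_assoc, ← pow_add, Nat.sub_add_cancel hj]

/-- A cube index of `𝐃_j` times `M` is a label of `T₁^{(j)}`: `x·M < |T₁^{(j)}|_dir` for `x < ⌈|T_η|_dir ∕ (LʲM)⌉` (`1 ≤ M`, `j ≤ m + K`). [cite: Balaban1987RG1, p.257 (the cubes π_j; bookkeeping)] -/
theorem val_mul_lt_sitesPerDir {j M : ℕ} (hj : j ≤ P.m + P.K) (hM : 1 ≤ M) (x : ZMod (Sect2.domCount P M j)) : x.val * M < P.sitesPerDir j := by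
  have hx : x.val < Sect2.domCount P M j := ZMod.val_lt x
  unfold Sect2.domCount at hx
  have hs : 0 < side P.L M j := by unfold side; exact Nat.mul_pos (pow_pos P.L_pos j) hM
  have h1 : x.val ≤ (P.sitesPerDir 0 - 1) / side P.L M j := by omega
  have h2 : x.val * side P.L M j ≤ P.sitesPerDir 0 - 1 := (Nat.le_div_iff_mul_le hs).1 h1
  have h3 : 0 < P.sitesPerDir 0 := Nat.pos_of_ne_zero (P.sitesPerDir_ne_zero 0)
  have h4 : x.val * M * P.L ^ j < P.sitesPerDir j * P.L ^ j := by
    rw [sitesPerDir_mul_pow hj]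
    have : x.val * side P.L M j = x.val * M * P.L ^ j := by unfold side; ring
    omega
  exact Nat.lt_of_mul_lt_mul_right h4

/-- **★ AN INJECTION `ι : cubes of 𝐃_j → T₁^{(j)}` WITH `toFine j (ι x)` INSIDE THE CUBE `x`** (read as fine sites, `Sect2.domSites`' cube `cubeEnl P (LʲM) (liftIdx x) 0`): `ι x = x·M`
coordinatewise; its centre `toFine j (ι x)` has `LʲM`-cube index `x` (`B10Eq71TorusOverlap.cubeIdx_toFine`: `⌊(toFine j c)_μ ∕ Lʲ⌋ = c_μ`). [cite: Balaban1987RG1, (0.1) p.251, p.257 (bookkeeping)] -/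
theorem exists_site_in_domCube {j M : ℕ} (hj : j ≤ P.m + P.K) (hM : 1 ≤ M) :
    ∃ ι : TPt P.d (Sect2.domCount P M j) → Site P j, Function.Injective ι ∧
      ∀ x, toFine j (ι x) ∈ cubeEnl P (side P.L M j) (Sect2.liftIdx P x) 0 := by
  refine ⟨fun x i => (((x i).val * M : ℕ) : ZMod (P.sitesPerDir j)), ?_, ?_⟩
  · intro x y hxy
    funext i
    have h := congrFun hxy i
    simp only at h
    have hx := val_mul_lt_sitesPerDir hj hM (x i)
    have hy := val_mul_lt_sitesPerDir hj hM (y i)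
    have h' : (x i).val * M = (y i).val * M := by
      have := congrArg ZMod.val h
      rwa [ZMod.val_natCast, ZMod.val_natCast, Nat.mod_eq_of_lt hx, Nat.mod_eq_of_lt hy] at this
    exact ZMod.val_injective _ (Nat.eq_of_mul_eq_mul_right hM h')
  · intro x
    refine ⟨lift P (toFine j fun i => (((x i).val * M : ℕ) : ZMod (P.sitesPerDir j))), fun i => ?_, cover_lift _⟩
    have hval : ((fun i => (((x i).val * M : ℕ) : ZMod (P.sitesPerDir j))) i : ZMod (P.sitesPerDir j)).val = (x i).val * M := by
      rw [ZMod.val_natCast, Nat.mod_eq_of_lt (val_mul_lt_sitesPerDir hj hM (x i))]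
    have hq : ((toFine j fun i => (((x i).val * M : ℕ) : ZMod (P.sitesPerDir j))) i).val / P.L ^ j = (x i).val * M := by
      have h := congrFun (B10Eq71TorusOverlap.cubeIdx_toFine hj (fun i => (((x i).val * M : ℕ) : ZMod (P.sitesPerDir j)))) i
      rw [hval] at h
      exact h
    set v := ((toFine j fun i => (((x i).val * M : ℕ) : ZMod (P.sitesPerDir j))) i).val with hv
    have hL : 0 < P.L ^ j := pow_pos P.L_pos j
    have h1 : P.L ^ j * ((x i).val * M) ≤ v := by rw [← hq]; exact Nat.mul_div_le v (P.L ^ j) |>.trans_eq' (by ring)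
    have h2 : v < P.L ^ j * ((x i).val * M + 1) := by
      rw [← hq]; exact (Nat.lt_div_mul_add hL).trans_eq (by ring)
    have hs : side P.L M j = P.L ^ j * M := rfl
    simp only [lift, Sect2.liftIdx, zero_mul, Nat.cast_zero, sub_zero, add_zero, hs]
    push_cast
    constructor
    · have : ((P.L : ℤ) ^ j * M) * ((x i).val : ℤ) ≤ (v : ℤ) := by exact_mod_cast (by linarith [h1] : P.L ^ j * M * (x i).val ≤ v)
      linarith
    · have hM' : P.L ^ j ≤ P.L ^ j * M := Nat.le_mul_of_pos_right _ hM
      have : (v : ℤ) + 1 ≤ ((P.L : ℤ) ^ j * M) * ((x i).val : ℤ) + (P.L : ℤ) ^ j * M := by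
        exact_mod_cast (by nlinarith [h2, hM'] : v + 1 ≤ P.L ^ j * M * (x i).val + P.L ^ j * M)
      linarith

end Torus

/-! ## §2. At the ₁₃ objects: the cube count `hcountR` -/

section AtRecord13

variable {F : T4Family} {N : ℕ} [NeZero N]
variable (θ : Stage13HParams F N) (p : B12.RunParams) {k : ℕ}

/-- **★★ THE p. 263 COUNT FOR THE CHOSEN CUBES, AT THE RECORD**: for a (2.18) history `s`, scales `1 ≤ j ≤ n ≤ m + K`, `1 ≤ M`, any finite set `Zc` of cubes of `𝐃_j` of record (e.g. the
chosen cubes `pick X` of the admissible domains) and any scale map `scR` whose scale-`n` cubes lie inside `Γ_n(s)` as fine-site sets (`hsc`): `#{x ∈ Zc : scR x = n} ≤ (L^{n−j})⁴·|Γ_n(s)|`,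
`|Γ_n(s)| := #{y ∈ T₁^{(n)} : y ∈ Γ_n(s)}` — the binder `hcountR` of `…Thm2RSideAtRecord13CoPH` ∕ `…OfSect3Sentences` at `L := (F.P p.K).L`.  Kernel: the injection of §1 into the scale-`j`
points of `Γ_n(s)`, then `hcount_at_record₁₃`'s count. [cite: Balaban1988Convergent, p.263 (after (2.43)), p.283, (2.1)–(2.2) pp.254–255] -/
theorem hcountR_at_record₁₃ (s : SeqOfRecord F θ.ν θ.τ9.M (gOfRecord₁₃ F N θ.toStage13Params p) p.K k) {j n : ℕ} (hj : 1 ≤ j) (hjn : j ≤ n)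
    (hn : n ≤ (F.P p.K).m + (F.P p.K).K) (hM : 1 ≤ θ.τ9.M) [∀ i, DecidablePred fun z : Site (F.P p.K) i => toFine i z ∈ gammaRegion s.Ω k n]
    (Zc : Finset (TPt (F.P p.K).d (Sect2.domCount (F.P p.K) θ.τ9.M j))) (scR : TPt (F.P p.K).d (Sect2.domCount (F.P p.K) θ.τ9.M j) → ℕ)
    (hsc : ∀ x ∈ Zc, scR x = n → cubeEnl (F.P p.K) (side (F.P p.K).L θ.τ9.M j) (Sect2.liftIdx (F.P p.K) x) 0 ⊆ gammaRegion s.Ω k n) :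
    ((Zc.filter fun x => scR x = n).card : ℝ) ≤
      (((F.P p.K).L : ℝ) ^ ((n : ℝ) - j)) ^ (4 : ℝ) * ((univ.filter fun y : Site (F.P p.K) n => toFine n y ∈ gammaRegion s.Ω k n).card : ℝ) := by
  classical
  obtain ⟨ι, hinj, hmem⟩ := exists_site_in_domCube (P := F.P p.K) (j := j) (M := θ.τ9.M) (hjn.trans hn) hM
  have h := hcount_at_record₁₃ θ p s hj hjn hn ((Zc.filter fun x => scR x = n).image ι) (fun _ => n)
    (fun z hz _ => by
      obtain ⟨x, hx, rfl⟩ := Finset.mem_image.mp hz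
      obtain ⟨hxZ, hxn⟩ := Finset.mem_filter.mp hx
      exact hsc x hxZ hxn (hmem x))
  rw [Finset.filter_true_of_mem (fun _ _ => rfl), Finset.card_image_of_injective _ hinj] at h
  exact h

end AtRecord13

end Summit.QuantumFields.YangMills.Theorems.BalabanUVNodesN11Thm2CubeCountAtRecord13CoPH

end
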